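import Literature.NumberTheory.EllipticCurves.Rank1Residual.X9CMPartner
import Literature.NumberTheory.EllipticCurves.CyclotomicIwasawaMainTheoremIrreducible
import Literature.NumberTheory.EllipticCurves.ModPReducibilityProofs
import Literature.NumberTheory.EllipticCurves.ModularCurvePeriodRatio
import Literature.NumberTheory.EllipticCurves.MordellWeilRankZeroProofs
import HarnessLib

/-!
# BSD rank-≤1 residual cell — class X9: `BSD(E,p)` from a congruent partner with TRIVIAL
# `p`-primary Iwasawa theory (route U2), both ranks, every image type

HONEST FRAMING (cell `b2b-bsdres-*`, verbatim): the goal of the cell is to DELETE the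
COMBINATION-SHAPED residual classes for ALL analytic-rank ≤ 1 curves over ℚ — "full BSD formula
for every rank ≤ 1 curve in class C" assembled STRICTLY from published theorems — so that the
rank-≤1 remainder becomes exactly the CONSTRUCTION-SHAPED classes, which are TYPED (missing-input
Props), NOT attempted; this is not "finishing BSD".

Theorems only (no definitions, no named facts; X9 prover gen 5). Class X9 (`Rank1Residual.ClassX9`:
non-CM, good ordinary `p ≥ 5`, `E[p]` irreducible, `ρ̄_{E,p}` not surjective; by `X9ImageShape`,
`p ∈ {5, 7}` and the image is the normaliser of a split Cartan subgroup or of projective type `𝔖₄`) is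
typed: every printed INTEGRAL cyclotomic main conjecture at a good ordinary prime passes through (im)
(Kato's `τ`), which is false on X9 (`X9SmallImage`). Gen 4 (route U1′, `X9CMPartner`) obtained the
integral main conjecture for the split-dihedral pairs whose mod-`p` representation is that of a CM
elliptic curve, by Rubin 1991 + Greenberg–Vatsal 2000 Thm. (1.4). THIS FILE records a second
transfer route that needs NO CM and therefore reaches the `𝔖₄`-type pairs (e.g. the census pair
`2268b1 @ 5`), from PUBLISHED theorems plus finite per-pair certificates:

**Route U2 (congruent partner with trivial `p`-primary arithmetic).** Let `A/ℚ` be an elliptic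
curve with `A[p] ≅ E[p]` (`Γ_ℚ`-equivariantly; certificate C1, finite by Kraus–Oesterlé 1992), good
ORDINARY and NON-ANOMALOUS at `p` (`p ∤ #Ã(𝔽_p)`), with `p ∤ ∏_ℓ c_ℓ(A)`, `L(A,1)/Ω_A` a `p`-adic
unit and `Sel_{p^∞}(A/ℚ) = 0` (for instance `r_an(A) = 0` and `BSD(A,p)` known, e.g. `N_A < 5000`
by Creutz–Miller). Then Greenberg's Euler-characteristic formula (LNM 1716 Thm. 4.1) makes a
generator of `char_Λ X(A/ℚ_∞)` a UNIT of `Λ` (`X(A/ℚ_∞)` is finite), while integrality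
(Greenberg–Vatsal 2000 Prop. 3.7, a tree theorem) and the interpolation formula make the
Néron-normalised `𝓛_p(A)` a unit of `Λ`: Mazur's main conjecture holds for `(A, p)` TRIVIALLY,
`Λ = Λ`, with `μ = λ = 0`. Greenberg–Vatsal 2000 Thm. (1.4) (with Kato's Thm. (1.2); tree fact
`GreenbergVatsal2000.thm14_mainConjecture_transfer_of_torsionIso`, p180188) transports the main
conjecture with `μ = 0` along `A[p] ≅ E[p]` to `(E, p)` — INTEGRALLY, with no hypothesis on the image
of `ρ̄_{E,p}`. The cell's glue then gives `BSD(E,p)` in analytic rank `0` (Greenberg 4.1 for `E`,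
`GreenbergVatsal2000.pPartRankZero_of_thm14`) and, with the Schneider certificate C3, in analytic
rank `1` (`Wuthrich2014.missingPPartAt_of_mainConjecture_of_rank_one`, Perrin-Riou–Schneider).

* `mazurMainConjecture_with_mu_zero_of_trivialArithmetic` — the partner side: good ordinary
  `p ≥ 5`, `A[p]` irreducible, the four certificates ⟹ for all cyclotomic data, newforms `f_A`,
  `ϖ_A Ω_A = Ω⁺_{f_A}` and dual data `D`: `X` torsion, `char X = (g)`, `p ∤ g`, `ι g = ϖ_A L_p(f_A,α)`.
* `X9.mazurMainConjecture_of_trivialPartner` — the integral main conjecture at the X9 pair `(E,p)`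
  with `μ = 0` (the pointwise content of the Summits-side typed input `IntegralMainConjectureOnClassX9`).
* `X9.bsdp_of_trivialPartner` (rank 0), `…_of_analyticRank_eq_one` (+ C3), `…_of_coeff_one_ne_zero`,
  `…_of_analyticRank_le_one`, `X9.missingInputAt_of_trivialPartner`, and the versions with C1 as the
  Kraus–Oesterlé congruence list (`…_of_congruences…`).
* `natCard_selmerGroupPInfty_eq_one_of_bsdp` and `…_of_conductor_lt` — how the partner's Selmer
  certificate is discharged from `BSD(A,p)` in rank `0`, in particular from Miller/Creutz–Miller
  (`bsdp_of_irreducible_of_conductor_lt`) when `N_A < 5000`.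

What this does NOT do: no pair is closed by these theorems until its certificates are lane-certified
(referee R17.3/R19.2 pattern); the class label (CONSTRUCTION-SHAPED, R6.8/R13.1) is unchanged; the
existence of a partner is a per-pair fact (prover's census: HOME/b2b-bsdres-x9/X9-U2-G5.md).
-/

set_option autoImplicit false

noncomputable section

open scoped Classical MatrixGroups ModularForm

open CongruenceSubgroup WeierstrassCurve Literature.NumberTheory.EllipticCurves
  Literature.NumberTheory.EllipticCurves.ModularForms

namespace Literature.NumberTheory.EllipticCurves.Rank1Residual

/-! ### Two valuation helpers on `ℤ_p ⊂ ℚ_p` -/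

/-- An element of `ℤ_p`, non-zero in `ℚ_p`, has non-negative valuation. [folklore] -/
theorem valuation_coe_padicInt_nonneg {p : ℕ} [Fact p.Prime] (x : ℤ_[p])
    (hx : ((x : ℤ_[p]) : ℚ_[p]) ≠ 0) : 0 ≤ ((x : ℤ_[p]) : ℚ_[p]).valuation := by
  have hp1 : (1 : ℝ) < p := by exact_mod_cast (Fact.out : p.Prime).one_lt
  have h1 : ‖((x : ℤ_[p]) : ℚ_[p])‖ ≤ 1 := by
    rw [PadicInt.padic_norm_e_of_padicInt]; exact PadicInt.norm_le_one x
  rw [Padic.norm_eq_zpow_neg_valuation hx] at h1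
  by_contra hlt
  rw [not_le] at hlt
  have : (1 : ℝ) < (p : ℝ) ^ (-((x : ℤ_[p]) : ℚ_[p]).valuation) := one_lt_zpow₀ hp1 (by omega)
  linarith

/-- An element of `ℤ_p` of valuation `0` in `ℚ_p` is a unit of `ℤ_p`. [folklore] -/
theorem isUnit_of_valuation_coe_eq_zero {p : ℕ} [Fact p.Prime] (x : ℤ_[p])
    (hx : ((x : ℤ_[p]) : ℚ_[p]) ≠ 0) (hv : ((x : ℤ_[p]) : ℚ_[p]).valuation = 0) : IsUnit x := by
  rw [PadicInt.isUnit_iff, ← PadicInt.padic_norm_e_of_padicInt, Padic.norm_eq_zpow_neg_valuation hx,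
    hv, neg_zero, zpow_zero]

/-! ### The partner side: trivial `p`-primary arithmetic ⟹ Mazur's main conjecture with `μ = 0` -/

/-- **A curve with trivial `p`-primary arithmetic satisfies Mazur's main conjecture at `p`, integrally,
with `μ = 0`.** Let `A/ℚ` (globally minimal) have good ordinary reduction at `p ≥ 5` with `A[p]`
irreducible, and assume the four CERTIFICATES of trivial `p`-primary arithmetic: `p ∤ #Ã(𝔽_p)`
(`hna`, non-anomalous), `p ∤ ∏_ℓ c_ℓ(A)` (`htam`), `L(A,1)/Ω_A` is a non-zero rational of `p`-adic
valuation `0` (`hL`), and `#Sel_{p^∞}(A/ℚ) = 1` (`hSel`). PUBLISHED inputs: Burungale–Castella–Skinner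
2025 Thm. 1.1.2 (a) (`hBCS`: `X(A/ℚ_∞)` is `Λ`-torsion with principal characteristic ideal — only this
much of it is used), Greenberg LNM 1716 Thm. 4.1 (`hGr`), the period ratio `Ω_A = u·Ω⁺_{f_A}` with `u`
a `p`-adic unit (`hΩ`, Greenberg–Vatsal 2000 §3 / Abbes–Ullmo), and the tree theorem
`padicLFunction_mem_integral_holds` (Greenberg–Vatsal 2000 Prop. 3.7). Conclusion, for all cyclotomic
data `(κ, γ)`, every newform `f_A` of `A`, `ϖ·Ω_A = Ω⁺_{f_A}` and every dual datum `D`: `X` is torsion,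
`char_Λ X = (g)` with `HasUnitContent g` (`μ = 0`) and `ι g = ϖ · L_p(f_A, α_A)`. Proof: Greenberg's
formula `g₀(0)·#A(ℚ)[p^∞]² ∼ p^{ord_p ∏c}·#Ã(𝔽_p)[p^∞]²·#Sel` forces `ord_p g₀(0) = 0`, so the BCS
generator `g₀` is a unit and `char X = Λ`; the power series `G := ϖ·L_p(f_A,α_A)` lies in `Λ`
(integrality, `‖ϖ‖_p = 1`) and `G(0) = ϖ(1-α⁻¹)²[0]⁺ = (1-α⁻¹)²·L(A,1)/Ω_A` is a unit
(`1 - α⁻¹ ∼ #Ã(𝔽_p)`), so `(G) = Λ = char X`. This is the situation of Greenberg–Vatsal 2000 §1 in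
which "the main conjecture is trivially true" for `E₁`.
[cite: GreenbergLNM1716, Thm. 4.1 (p. 102)] [cite: GreenbergVatsal2000, Prop. 3.7 and §1]
[cite: BurungaleCastellaSkinner2025, Thm. 1.1.2 (a) (p. 2 of arXiv:2405.00270v2)] -/
theorem mazurMainConjecture_with_mu_zero_of_trivialArithmetic
    (hBCS : burungale_castella_skinner_charIdeal_eq_padicLFunction)
    (hGr : greenberg_charValue_rankZero) (hΩ : realPeriodRat_eq_unit_mul_plusPeriod)
    (A : WeierstrassCurve ℚ) [A.IsElliptic] [A.IsGloballyMinimal] (p : ℕ) [Fact p.Prime]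
    (h5 : 5 ≤ p) (hgood : A.HasGoodReductionAtPrime p) (hord : ¬ (p : ℤ) ∣ A.frobeniusTrace p)
    (hirr : A.HasIrreducibleModPGaloisRep p)
    (hna : ¬ p ∣ A.reductionPointCount p) (htam : ¬ p ∣ A.tamagawaProduct)
    (hL : ∃ q : ℚ, q ≠ 0 ∧ A.entireLFunction 1 / (A.realPeriodRat : ℂ) = (q : ℂ) ∧ padicValRat p q = 0)
    (hSel : Nat.card (A.selmerGroupPInfty p) = 1) :
    ∀ (κ : ZpExtension ℚ p) (γ : Field.absoluteGaloisGroup ℚ),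
        κ.IsCyclotomic → κ.IsTopGenerator γ → IsCyclotomicVariable p γ →
      ∀ [NeZero (A.conductorNorm ℤ)] (fA : CuspForm (Gamma0 (A.conductorNorm ℤ)) 2),
        IsNewformOf A fA → ∀ (ϖ : ℚ), (ϖ : ℝ) * A.realPeriodRat = plusPeriod fA →
      ∀ (D : A.SelmerDualData κ γ), D.IsTorsion ∧
        ∃ g : IwasawaAlgebra p, D.charIdeal = Ideal.span {g} ∧
          GreenbergVatsal2000.HasUnitContent g ∧
          iwasawaToPowerSeries p g =
            PowerSeries.C (ϖ : ℚ_[p]) * padicLFunction fA (unitRoot A p : ℚ_[p]) := by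
  intro κ γ hκ hγ hγ' _ fA hf ϖ hϖeq D
  have hpP : p.Prime := Fact.out
  have hp2 : p ≠ 2 := by omega
  have hordp : IsOrdinaryAt A p := ⟨hgood, hord⟩
  haveI : Module.Finite (IwasawaAlgebra p) D.X := D.module_finite_holds hγ
  haveI : NeZero p := ⟨hpP.ne_zero⟩
  have hp0 : (p : ℚ_[p]) ≠ 0 := Nat.cast_ne_zero.mpr hpP.ne_zero
  -- the rational number `t = ϖ · [0]⁺ = L(A,1)/Ω_A` and its valuation
  obtain ⟨q, hq0, hqeq, hqv⟩ := hL
  set s : ℚ := ratPlusSymbol fA 0 with hs_def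
  have hΩpos : 0 < A.realPeriodRat := A.realPeriodRat_pos_holds
  have hLval : A.entireLFunction 1 = (((s : ℝ) * plusPeriod fA : ℝ) : ℂ) := hf.entireLFunction_one_eq
  have ht : A.entireLFunction 1 / (A.realPeriodRat : ℂ) = ((ϖ * s : ℚ) : ℂ) := by
    rw [hLval, ← hϖeq, div_eq_iff (Complex.ofReal_ne_zero.mpr hΩpos.ne')]
    push_cast
    ring
  have hqt : q = ϖ * s := by
    have h := hqeq.symm.trans ht
    exact_mod_cast h
  have hplus : plusPeriod fA ≠ 0 := by
    intro h0
    apply hq0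
    rw [hqt]
    have : A.entireLFunction 1 = 0 := by rw [hLval, h0]; simp
    have h2 := ht
    rw [this, zero_div] at h2
    exact_mod_cast h2.symm
  -- `‖ϖ‖_p = 1` from `Ω_A = u · Ω⁺_{f_A}` with `u` a `p`-adic unit
  obtain ⟨u, hu1, huΩ⟩ := hΩ A p h5 hgood hirr fA hf
  have hϖu : ϖ * u = 1 := by
    have h1 : ((ϖ * u : ℚ) : ℝ) * plusPeriod fA = ((1 : ℚ) : ℝ) * plusPeriod fA := by
      calc ((ϖ * u : ℚ) : ℝ) * plusPeriod fA = (ϖ : ℝ) * ((u : ℝ) * plusPeriod fA) := by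
            push_cast; ring
        _ = (ϖ : ℝ) * A.realPeriodRat := by rw [← huΩ]
        _ = plusPeriod fA := hϖeq
        _ = ((1 : ℚ) : ℝ) * plusPeriod fA := by push_cast; rw [one_mul]
    exact_mod_cast mul_right_cancel₀ hplus h1
  have hϖnorm : ‖(ϖ : ℚ_[p])‖ = 1 := by
    have h := congrArg (fun r : ℚ => ‖(r : ℚ_[p])‖) hϖu
    simp only [Rat.cast_mul, norm_mul, hu1, mul_one, Rat.cast_one, norm_one] at h
    exact h
  -- Step 1 (BCS (a), rationally): `X` torsion, `char X = (g₀)`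
  obtain ⟨hX, g₀, k, hchar, -⟩ := hBCS A p κ γ fA h5 hgood hord hirr hκ hγ hγ' hf D
  -- Step 2 (Greenberg's Thm. 4.1 with `#Sel = 1`, `p ∤ ∏c`, `p ∤ #Ã(𝔽_p)`): `g₀` is a unit of `Λ`
  have hSelfin : Finite (A.selmerGroupPInfty p) :=
    Nat.finite_of_card_ne_zero (by rw [hSel]; exact one_ne_zero)
  obtain ⟨hEfin, -⟩ := (A.finite_selmerGroupPInfty_iff p).mp hSelfin
  haveI := hEfin
  obtain ⟨u₁, hu₁⟩ := hGr A p hp2 hgood hord κ γ hκ hγ hγ' D hX g₀ hchar hSelfin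
  obtain ⟨u₃, hu₃⟩ := exists_unit_natCard_eq_mul_card_primaryComponent
    ((integralModelInt A).map (Int.castRingHom (ZMod p))).toAffine.Point p
  set Np : ℚ_[p] := (Nat.card (AddCommGroup.primaryComponent
    ((integralModelInt A).map (Int.castRingHom (ZMod p))).toAffine.Point p) : ℚ_[p]) with hNp
  set Tp : ℚ_[p] := (Nat.card (AddCommGroup.primaryComponent A.toAffine.Point p) : ℚ_[p]) with hTp
  have hNcount : (A.reductionPointCount p : ℚ_[p]) = ((u₃ : ℤ_[p]) : ℚ_[p]) * Np := by
    rw [WeierstrassCurve.reductionPointCount, hNp]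
    exact hu₃
  have hNp0 : Np ≠ 0 := by rw [hNp]; exact_mod_cast Nat.card_pos.ne'
  have hTp0 : Tp ≠ 0 := by rw [hTp]; exact_mod_cast Nat.card_pos.ne'
  have hvNp : Np.valuation = 0 := by
    have h := congrArg Padic.valuation hNcount
    rw [Padic.valuation_natCast, Padic.valuation_mul (coe_units_ne_zero p u₃) hNp0,
      valuation_coe_units_eq_zero, zero_add, padicValNat.eq_zero_of_not_dvd hna] at h
    exact_mod_cast h.symm
  have hv0 : padicValNat p A.tamagawaProduct = 0 := padicValNat.eq_zero_of_not_dvd htam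
  rw [hv0, pow_zero, mul_one, hSel, Nat.cast_one, mul_one] at hu₁
  -- `hu₁ : g₀(0) · Tp² = u₁ · Np²`
  have hg00 : ((PowerSeries.constantCoeff g₀ : ℤ_[p]) : ℚ_[p]) ≠ 0 := by
    intro h
    rw [h, zero_mul] at hu₁
    exact (mul_ne_zero (coe_units_ne_zero p u₁) (pow_ne_zero 2 hNp0)) hu₁.symm
  have hvg0 : ((PowerSeries.constantCoeff g₀ : ℤ_[p]) : ℚ_[p]).valuation = 0 := by
    have h := congrArg Padic.valuation hu₁
    rw [Padic.valuation_mul hg00 (pow_ne_zero 2 hTp0), Padic.valuation_pow,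
      Padic.valuation_mul (coe_units_ne_zero p u₁) (pow_ne_zero 2 hNp0), valuation_coe_units_eq_zero,
      Padic.valuation_pow, hvNp, mul_zero, zero_add] at h
    have hT : 0 ≤ Tp.valuation := by
      rw [hTp, Padic.valuation_natCast]; exact_mod_cast Nat.zero_le _
    have hg : 0 ≤ ((PowerSeries.constantCoeff g₀ : ℤ_[p]) : ℚ_[p]).valuation :=
      valuation_coe_padicInt_nonneg _ hg00
    simp only [Nat.cast_ofNat] at h
    linarith
  have hg0unit : IsUnit g₀ :=
    PowerSeries.isUnit_iff_constantCoeff.mpr (isUnit_of_valuation_coe_eq_zero _ hg00 hvg0)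
  have hchar_top : D.charIdeal = ⊤ := by rw [hchar, Ideal.span_singleton_eq_top]; exact hg0unit
  -- Step 3 (integrality): `G := ϖ · L_p(f_A, α) ∈ Λ`
  set L := padicLFunction fA (unitRoot A p : ℚ_[p]) with hLdef
  have hcoef : ∀ n : ℕ, ‖PowerSeries.coeff n (PowerSeries.C (ϖ : ℚ_[p]) * L)‖ ≤ 1 := by
    intro n
    rw [PowerSeries.coeff_C_mul, norm_mul, hϖnorm, one_mul, hLdef, coeff_padicLFunction]
    exact padicLFunction_mem_integral_holds hp2 hordp hf hirr n
  set G : IwasawaAlgebra p := PowerSeries.mk fun n =>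
    (⟨PowerSeries.coeff n (PowerSeries.C (ϖ : ℚ_[p]) * L), hcoef n⟩ : ℤ_[p]) with hGdef
  have hιG : iwasawaToPowerSeries p G = PowerSeries.C (ϖ : ℚ_[p]) * L := by
    ext n
    rw [iwasawaToPowerSeries, PowerSeries.coeff_map, hGdef, PowerSeries.coeff_mk]
    rfl
  -- Step 4 (interpolation): `G(0) = ϖ (1 - α⁻¹)² [0]⁺_{f_A}` is a unit
  set a : ℚ_[p] := ((unitRoot A p : ℤ_[p]) : ℚ_[p]) with ha
  obtain ⟨u₂, hu₂⟩ := exists_unit_one_sub_unitRoot_inv p A hordp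
  have h1a : (1 - a⁻¹) = ((u₂ : ℤ_[p]) : ℚ_[p]) * ((u₃ : ℤ_[p]) : ℚ_[p]) * Np := by
    rw [ha, hu₂, hNcount, mul_assoc]
  have h1a0 : (1 - a⁻¹) ≠ 0 := by
    rw [h1a]; exact mul_ne_zero (mul_ne_zero (coe_units_ne_zero p u₂) (coe_units_ne_zero p u₃)) hNp0
  have hv1a : (1 - a⁻¹).valuation = 0 := by
    rw [h1a, Padic.valuation_mul (mul_ne_zero (coe_units_ne_zero p u₂) (coe_units_ne_zero p u₃)) hNp0,
      Padic.valuation_mul (coe_units_ne_zero p u₂) (coe_units_ne_zero p u₃),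
      valuation_coe_units_eq_zero, valuation_coe_units_eq_zero, hvNp, add_zero, add_zero]
  have htQ0 : ((q : ℚ) : ℚ_[p]) ≠ 0 := by exact_mod_cast hq0
  have hG0 : ((PowerSeries.constantCoeff G : ℤ_[p]) : ℚ_[p]) = (1 - a⁻¹) ^ 2 * (q : ℚ_[p]) := by
    rw [← constantCoeff_iwasawaToPowerSeries p G, hιG, map_mul, PowerSeries.constantCoeff_C, hLdef,
      constantCoeff_padicLFunction_unitRoot hordp hf, hqt]
    push_cast
    rw [ha]
    ring
  have hG00 : ((PowerSeries.constantCoeff G : ℤ_[p]) : ℚ_[p]) ≠ 0 := by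
    rw [hG0]; exact mul_ne_zero (pow_ne_zero 2 h1a0) htQ0
  have hvG0 : ((PowerSeries.constantCoeff G : ℤ_[p]) : ℚ_[p]).valuation = 0 := by
    rw [hG0, Padic.valuation_mul (pow_ne_zero 2 h1a0) htQ0, Padic.valuation_pow, hv1a,
      Padic.valuation_ratCast, hqv]
    simp
  have hG0unit : IsUnit (PowerSeries.constantCoeff G) := isUnit_of_valuation_coe_eq_zero _ hG00 hvG0
  have hGunit : IsUnit G := PowerSeries.isUnit_iff_constantCoeff.mpr hG0unit
  refine ⟨hX, G, ?_, ⟨0, ?_⟩, hιG⟩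
  · rw [hchar_top, eq_comm, Ideal.span_singleton_eq_top]; exact hGunit
  · rw [PowerSeries.coeff_zero_eq_constantCoeff]; exact hG0unit

/-! ### Discharging the partner's Selmer certificate from `BSD(A,p)` in analytic rank 0 -/

/-- **`#Sel_{p^∞}(A/ℚ) = 1` from `BSD(A,p)` in analytic rank `0`.** If `r_an(A) = 0`, `A[p]` is
irreducible (so `p ∤ #A(ℚ)_tors`), `p ∤ ∏ c_ℓ(A)`, `L(A,1)/Ω_A` is a non-zero rational of valuation
`0`, and Miller's `BSDp A p` holds, then `Ш(A/ℚ)[p^∞] = 0` and hence (rank `0`, `A(ℚ)` finite)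
`#Sel_{p^∞}(A/ℚ) = #Ш(A/ℚ)[p^∞] = 1`. Inputs: Gross–Zagier–Kolyvagin (`hGZK`, finiteness of `Ш` in
analytic rank `≤ 1`), the tree theorems `natCard_selmerGroupPInfty_eq_natCard_primaryComponent_sha`
(Greenberg LNM 1716 p. 103) and `mordellWeilRank_eq_zero_iff_finite`. [cite: Miller2011LMS, Def. 1.1]
[cite: GreenbergLNM1716, §4 p. 103] -/
theorem natCard_selmerGroupPInfty_eq_one_of_bsdp
    (hGZK : rank_eq_analyticRank_of_analyticRank_le_one)
    (A : WeierstrassCurve ℚ) [A.IsElliptic] [A.IsGloballyMinimal] (p : ℕ) [Fact p.Prime]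
    (hirrA : A.HasIrreducibleModPGaloisRep p) (hr : A.analyticRank = 0)
    (htam : ¬ p ∣ A.tamagawaProduct)
    (hL : ∃ q : ℚ, q ≠ 0 ∧ A.entireLFunction 1 / (A.realPeriodRat : ℂ) = (q : ℂ) ∧ padicValRat p q = 0)
    (hbsd : BSDp A p) : Nat.card (A.selmerGroupPInfty p) = 1 := by
  have hpP : p.Prime := Fact.out
  obtain ⟨hrank, hfin, q', hsha, hval⟩ := hbsd
  have hr0 : A.mordellWeilRank = 0 := hrank.trans hr
  haveI : Finite A.toAffine.Point := A.mordellWeilRank_eq_zero_iff_finite.mp hr0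
  haveI : Finite A.sha := (hGZK A (by omega)).2
  haveI := hfin
  rw [A.natCard_selmerGroupPInfty_eq_natCard_primaryComponent_sha p]
  obtain ⟨q, hq0, hqeq, hqv⟩ := hL
  have hΩ : 0 < A.realPeriodRat := A.realPeriodRat_pos_holds
  have hΩC : (A.realPeriodRat : ℂ) ≠ 0 := Complex.ofReal_ne_zero.mpr hΩ.ne'
  have hT : 0 < A.torsionOrder := A.torsionOrder_pos_holds
  have hc : 0 < A.tamagawaProduct := A.tamagawaProduct_pos'
  have hT0 : (A.torsionOrder : ℚ) ≠ 0 := by exact_mod_cast hT.ne'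
  have hc0 : (A.tamagawaProduct : ℚ) ≠ 0 := by exact_mod_cast hc.ne'
  have hReg : A.regulator = 1 := A.regulator_eq_one_of_rank_zero hr0
  have hL1 : A.entireLFunction 1 = (q : ℂ) * (A.realPeriodRat : ℂ) := by
    rw [← hqeq, div_mul_cancel₀ _ hΩC]
  have hq' : q' = q * (A.torsionOrder : ℚ) ^ 2 / (A.tamagawaProduct : ℚ) := by
    have h : shaAn A = ((q * (A.torsionOrder : ℚ) ^ 2 / (A.tamagawaProduct : ℚ) : ℚ) : ℂ) := by
      rw [shaAn_def, A.leadingLCoeff_eq_of_analyticRank_eq_zero hr, hL1, hReg]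
      have hcC : ((A.tamagawaProduct : ℚ) : ℂ) ≠ 0 := by exact_mod_cast hc.ne'
      push_cast
      field_simp
    rw [hsha] at h
    exact_mod_cast h
  have hv : padicValRat p q' = 0 := by
    rw [hq', padicValRat.div (mul_ne_zero hq0 (pow_ne_zero 2 hT0)) hc0,
      padicValRat.mul hq0 (pow_ne_zero 2 hT0), padicValRat.pow, hqv, padicValRat.of_nat,
      padicValRat.of_nat, padicValNat_torsionOrder_eq_zero_of_irreducible A p hirrA,
      padicValNat.eq_zero_of_not_dvd htam]
    simp
  rw [hv, card_addPrimaryComponent_eq_pow (A := A.sha) p, padicValNat.prime_pow] at hval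
  rw [card_addPrimaryComponent_eq_pow (A := A.sha) p]
  have he : (Nat.card A.sha).factorization p = 0 := by exact_mod_cast hval.symm
  rw [he, pow_zero]

/-- **The partner's Selmer certificate from Miller / Creutz–Miller when `N_A < 5000`.** With the
named fact `bsdp_of_irreducible_of_conductor_lt` (Miller 2011 Thm. 1.2 + Creutz–Miller 2012:
`BSD(A,p)` for `r_an(A) ≤ 1`, `N_A < 5000`, `A[p]` irreducible), the previous theorem yields
`#Sel_{p^∞}(A/ℚ) = 1` for a rank-`0` partner of conductor `< 5000` from the two finite certificates
`p ∤ ∏ c_ℓ(A)` and `ord_p(L(A,1)/Ω_A) = 0`. [cite: Miller2011LMS, Thm. 1.2] [cite: CreutzMiller2012, Thm. 1.1] -/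
theorem natCard_selmerGroupPInfty_eq_one_of_conductor_lt
    (hMiller : bsdp_of_irreducible_of_conductor_lt)
    (hGZK : rank_eq_analyticRank_of_analyticRank_le_one)
    (A : WeierstrassCurve ℚ) [A.IsElliptic] [A.IsGloballyMinimal] (p : ℕ) [Fact p.Prime]
    (hirrA : A.HasIrreducibleModPGaloisRep p) (hr : A.analyticRank = 0)
    (hN : A.conductorNorm ℤ < 5000) (htam : ¬ p ∣ A.tamagawaProduct)
    (hL : ∃ q : ℚ, q ≠ 0 ∧ A.entireLFunction 1 / (A.realPeriodRat : ℂ) = (q : ℂ) ∧ padicValRat p q = 0) :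
    Nat.card (A.selmerGroupPInfty p) = 1 :=
  natCard_selmerGroupPInfty_eq_one_of_bsdp hGZK A p hirrA hr htam hL
    (hMiller A (by omega) hN p Fact.out hirrA)

/-! ### Transfer to the X9 pair along `A[p] ≅ E[p]` (Greenberg–Vatsal 2000, Thm. (1.4)) -/

section TrivialPartner

variable (W A : WeierstrassCurve ℚ) [W.IsElliptic] [W.IsGloballyMinimal] [A.IsElliptic]
  [A.IsGloballyMinimal] (p : ℕ) [Fact p.Prime]

/-- **Route U2: Mazur's main conjecture at an X9 pair `(E, p)`, integrally, with `μ = 0`, from a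
congruent partner with trivial `p`-primary arithmetic.** For `W` globally minimal with `ClassX9 W p`
and a globally minimal `A` good ordinary at `p` carrying the four certificates of
`mazurMainConjecture_with_mu_zero_of_trivialArithmetic` (`hna`, `htam`, `hL`, `hSel`), GIVEN the
certificate C1 (`hC1`: a `Γ_ℚ`-equivariant `A[p] ≃ E[p]`): for all cyclotomic data, the newform `f`
of `E`, `ϖ·Ω_E = Ω⁺_f` and every dual datum `D`, `X(E/ℚ_∞)` is `Λ`-torsion and `char_Λ X = (g)` with
`p ∤ g` and `ι g = ϖ·L_p(f, α)`. This is the conclusion of BCS 2025 Thm. 1.1.2 (b) at a pair where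
its hypothesis (im) is FALSE (`ClassX9.not_bigIm`), for EVERY image type of `ρ̄_{E,p}` (split-Cartan
normaliser or `𝔖₄`), from Greenberg–Vatsal's transfer (`hGV`, with Kato's Thm. (1.2) inside) — the
irreducibility of `A[p]` being that of `E[p]` transported along C1.
[cite: GreenbergVatsal2000, Thm. (1.4) (arXiv p. 5)] [cite: GreenbergLNM1716, Thm. 4.1 (p. 102)] -/
theorem X9.mazurMainConjecture_of_trivialPartner
    (hBCS : burungale_castella_skinner_charIdeal_eq_padicLFunction)
    (hGr : greenberg_charValue_rankZero) (hΩ : realPeriodRat_eq_unit_mul_plusPeriod)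
    (hGV : GreenbergVatsal2000.thm14_mainConjecture_transfer_of_torsionIso)
    (hX9 : ClassX9 W p)
    (hgoodA : A.HasGoodReductionAtPrime p) (hordA : ¬ (p : ℤ) ∣ A.frobeniusTrace p)
    (hna : ¬ p ∣ A.reductionPointCount p) (htam : ¬ p ∣ A.tamagawaProduct)
    (hL : ∃ q : ℚ, q ≠ 0 ∧ A.entireLFunction 1 / (A.realPeriodRat : ℂ) = (q : ℂ) ∧ padicValRat p q = 0)
    (hSel : Nat.card (A.selmerGroupPInfty p) = 1)
    (hC1 : ∃ e : geomTorsion A (p : ℤ) ≃+ geomTorsion W (p : ℤ),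
      ∀ (σ : Field.absoluteGaloisGroup ℚ) (P : geomTorsion A (p : ℤ)), e (σ • P) = σ • e P) :
    ∀ (κ : ZpExtension ℚ p) (γ : Field.absoluteGaloisGroup ℚ),
        κ.IsCyclotomic → κ.IsTopGenerator γ → IsCyclotomicVariable p γ →
      ∀ [NeZero (W.conductorNorm ℤ)] (f : CuspForm (Gamma0 (W.conductorNorm ℤ)) 2),
        IsNewformOf W f → ∀ (ϖ : ℚ), (ϖ : ℝ) * W.realPeriodRat = plusPeriod f →
      ∀ (D : W.SelmerDualData κ γ), D.IsTorsion ∧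
        ∃ g : IwasawaAlgebra p, D.charIdeal = Ideal.span {g} ∧
          GreenbergVatsal2000.HasUnitContent g ∧
          iwasawaToPowerSeries p g =
            PowerSeries.C (ϖ : ℚ_[p]) * padicLFunction f (unitRoot W p : ℚ_[p]) := by
  obtain ⟨-, ⟨hgood, hord⟩, h5, hirr, -, -⟩ := hX9
  have hp2 : p ≠ 2 := by omega
  obtain ⟨e, he⟩ := hC1
  have hirrA : A.HasIrreducibleModPGaloisRep p :=
    hasIrreducibleModPGaloisRep_of_torsionIso_symm e he hirr
  intro κ γ hκ hγ hγ'
  exact hGV A W p hp2 hgoodA hordA hgood hord ⟨e, he⟩ hirrA hirr κ γ hκ hγ hγ'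
    (mazurMainConjecture_with_mu_zero_of_trivialArithmetic hBCS hGr hΩ A p h5 hgoodA hordA hirrA
      hna htam hL hSel κ γ hκ hγ hγ')

/-! ### Rank 0 -/

/-- **Kernel theorem of route U2, analytic rank 0: `BSD(E,p)` on class X9 from a congruent partner
with trivial `p`-primary arithmetic and the certificate C1.** PUBLISHED named facts:
Burungale–Castella–Skinner 2025 Thm. 1.1.2 (a) (`hBCS`, used for `A` only: torsion + principal
characteristic ideal), Greenberg LNM 1716 Thm. 4.1 (`hGr`, for `A` and for `E`), the period ratio
(`hΩ`), Greenberg–Vatsal 2000 Thm. (1.4) + (1.2) (`hGV`), modularity with an integral Manin constant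
(`hmodP`), analytic continuation (`hmodL`), Gross–Zagier–Kolyvagin (`hGZK`); the class `ClassX9 W p`
and `W.analyticRank = 0`; the partner `A` (good ordinary at `p`) with the certificates `hna`, `htam`,
`hL`, `hSel`; the congruence certificate C1 (`hC1`). Conclusion: Miller's `BSDp W p`. Proof: the
integral main conjecture for `E` (`X9.mazurMainConjecture_of_trivialPartner`) feeds the rank-0 glue
`GreenbergVatsal2000.pPartRankZero_of_thm14` (interpolation, Greenberg's Euler characteristic,
cancellation of the anomalous factor) and `bsdp_of_pPartRankZero`. No pair is closed by this theorem
until its certificates are certified for it; nothing beyond the named facts is asserted.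
[cite: GreenbergVatsal2000, Thm. (1.4) (arXiv p. 5)] [cite: GreenbergLNM1716, Thm. 4.1 (p. 102)]
[cite: CastellaEtAl2021, Thm. 5.1.4 and its proof (the rank-0 descent)] -/
theorem X9.bsdp_of_trivialPartner
    (hBCS : burungale_castella_skinner_charIdeal_eq_padicLFunction)
    (hGr : greenberg_charValue_rankZero) (hΩ : realPeriodRat_eq_unit_mul_plusPeriod)
    (hGV : GreenbergVatsal2000.thm14_mainConjecture_transfer_of_torsionIso)
    (hmodP : nonempty_modularParametrizationData) (hmodL : hasEntireLFunction_rat)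
    (hGZK : rank_eq_analyticRank_of_analyticRank_le_one)
    (hX9 : ClassX9 W p) (hr : W.analyticRank = 0)
    (hgoodA : A.HasGoodReductionAtPrime p) (hordA : ¬ (p : ℤ) ∣ A.frobeniusTrace p)
    (hna : ¬ p ∣ A.reductionPointCount p) (htam : ¬ p ∣ A.tamagawaProduct)
    (hL : ∃ q : ℚ, q ≠ 0 ∧ A.entireLFunction 1 / (A.realPeriodRat : ℂ) = (q : ℂ) ∧ padicValRat p q = 0)
    (hSel : Nat.card (A.selmerGroupPInfty p) = 1)
    (hC1 : ∃ e : geomTorsion A (p : ℤ) ≃+ geomTorsion W (p : ℤ),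
      ∀ (σ : Field.absoluteGaloisGroup ℚ) (P : geomTorsion A (p : ℤ)), e (σ • P) = σ • e P) :
    BSDp W p := by
  obtain ⟨-, ⟨hgood, hord⟩, h5, hirr, -, -⟩ := id hX9
  have hp2 : p ≠ 2 := by omega
  obtain ⟨e, he⟩ := hC1
  have hirrA : A.HasIrreducibleModPGaloisRep p :=
    hasIrreducibleModPGaloisRep_of_torsionIso_symm e he hirr
  have hL1 : W.entireLFunction 1 ≠ 0 := (W.analyticRank_eq_zero_iff_holds (hmodL W)).1 hr
  exact bsdp_of_pPartRankZero W p hmodL hGZK hr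
    (GreenbergVatsal2000.pPartRankZero_of_thm14 A W p hGV hmodP hGZK hp2 hgoodA hordA hgood hord
      ⟨e, he⟩ hirrA
      (mazurMainConjecture_with_mu_zero_of_trivialArithmetic hBCS hGr hΩ A p h5 hgoodA hordA hirrA
        hna htam hL hSel)
      hL1 (hGr W p hp2 hgood hord))

/-! ### Rank 1 -/

/-- **Kernel theorem of route U2, analytic rank 1: `BSD(E,p)` on class X9 from a congruent partner
with trivial `p`-primary arithmetic, C1, and the Schneider certificate C3.** As in
`X9.bsdp_of_trivialPartner`, with `W.analyticRank = 1` and, in place of Greenberg's rank-0 formula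
for `E`, the cell's rank-one engine `Wuthrich2014.missingPPartAt_of_mainConjecture_of_rank_one`
(PUBLISHED inputs Perrin-Riou–Schneider `hS` = Balakrishnan–Müller–Stein 2016 Thm. 1.7 and
Perrin-Riou 1987 §1.4 Cor. 1.8 `hPR`; valid for any image of `ρ̄_{E,p}`), plus the per-curve
certificate C3 (`hC3`: Schneider's non-degeneracy of the canonical cyclotomic `p`-adic height,
⟺ `[T¹]L_p ≠ 0`, see `…_of_coeff_one_ne_zero`). [cite: GreenbergVatsal2000, Thm. (1.4) (arXiv p. 5)]
[cite: PerrinRiou1987, §1.4 Cor. 1.8] [cite: BalakrishnanMullerStein2015, Thm. 1.7] -/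
theorem X9.bsdp_of_trivialPartner_of_analyticRank_eq_one
    (hBCS : burungale_castella_skinner_charIdeal_eq_padicLFunction)
    (hGr : greenberg_charValue_rankZero) (hΩ : realPeriodRat_eq_unit_mul_plusPeriod)
    (hGV : GreenbergVatsal2000.thm14_mainConjecture_transfer_of_torsionIso)
    (hS : Schneider1985_order_charGenerator) (hPR : perrinRiou_rankOne_leadingTerms)
    (hmodP : nonempty_modularParametrizationData)
    (hGZK : rank_eq_analyticRank_of_analyticRank_le_one)
    (hX9 : ClassX9 W p) (hr : W.analyticRank = 1)
    (hgoodA : A.HasGoodReductionAtPrime p) (hordA : ¬ (p : ℤ) ∣ A.frobeniusTrace p)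
    (hna : ¬ p ∣ A.reductionPointCount p) (htam : ¬ p ∣ A.tamagawaProduct)
    (hL : ∃ q : ℚ, q ≠ 0 ∧ A.entireLFunction 1 / (A.realPeriodRat : ℂ) = (q : ℂ) ∧ padicValRat p q = 0)
    (hSel : Nat.card (A.selmerGroupPInfty p) = 1)
    (hC1 : ∃ e : geomTorsion A (p : ℤ) ≃+ geomTorsion W (p : ℤ),
      ∀ (σ : Field.absoluteGaloisGroup ℚ) (P : geomTorsion A (p : ℤ)), e (σ • P) = σ • e P)
    (hC3 : ∀ Dh : PAdicHeightData W p, Dh.IsCanonical → SchneiderConjecture Dh) :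
    BSDp W p := by
  obtain ⟨-, ⟨hgood, hord⟩, h5, -, -, -⟩ := id hX9
  have hMC := X9.mazurMainConjecture_of_trivialPartner W A p hBCS hGr hΩ hGV hX9 hgoodA hordA hna
    htam hL hSel hC1
  refine Typed.bsdp_of_missingPPartAt W p hGZK (by omega)
    (Wuthrich2014.missingPPartAt_of_mainConjecture_of_rank_one hS hPR hmodP hGZK W p h5 hgood
      hord hr hC3 ?_)
  intro κ γ hκ hγ hγ' _ f hf ϖ hϖ D
  obtain ⟨htors, g, hchar, -, hg⟩ := hMC κ γ hκ hγ hγ' f hf ϖ hϖ D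
  exact ⟨htors, g, hchar, hg⟩

/-- **Rank 1, with C3 in the form the lane computes it** (`[T¹]L_p(f, α, T) ≠ 0` for some newform `f`
of `E`): Schneider's non-degeneracy follows (`Wuthrich2014.coeff_one_padicLFunction_ne_zero_iff_schneider`,
Perrin-Riou 1987 + GZK) and the previous theorem applies. [cite: PerrinRiou1987, §1.4 Cor. 1.8]
[cite: SteinWuthrich2013, §§3–4 and §9] -/
theorem X9.bsdp_of_trivialPartner_of_coeff_one_ne_zero
    (hBCS : burungale_castella_skinner_charIdeal_eq_padicLFunction)
    (hGr : greenberg_charValue_rankZero) (hΩ : realPeriodRat_eq_unit_mul_plusPeriod)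
    (hGV : GreenbergVatsal2000.thm14_mainConjecture_transfer_of_torsionIso)
    (hS : Schneider1985_order_charGenerator) (hPR : perrinRiou_rankOne_leadingTerms)
    (hmodP : nonempty_modularParametrizationData)
    (hGZK : rank_eq_analyticRank_of_analyticRank_le_one)
    (hX9 : ClassX9 W p) (hr : W.analyticRank = 1)
    (hgoodA : A.HasGoodReductionAtPrime p) (hordA : ¬ (p : ℤ) ∣ A.frobeniusTrace p)
    (hna : ¬ p ∣ A.reductionPointCount p) (htam : ¬ p ∣ A.tamagawaProduct)
    (hL : ∃ q : ℚ, q ≠ 0 ∧ A.entireLFunction 1 / (A.realPeriodRat : ℂ) = (q : ℂ) ∧ padicValRat p q = 0)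
    (hSel : Nat.card (A.selmerGroupPInfty p) = 1)
    (hC1 : ∃ e : geomTorsion A (p : ℤ) ≃+ geomTorsion W (p : ℤ),
      ∀ (σ : Field.absoluteGaloisGroup ℚ) (P : geomTorsion A (p : ℤ)), e (σ • P) = σ • e P)
    {N : ℕ} [NeZero N] (f : CuspForm (Gamma0 N) 2) (hf : IsNewformOf W f)
    (hC3 : PowerSeries.coeff 1 (padicLFunction f (unitRoot W p : ℚ_[p])) ≠ 0) :
    BSDp W p := by
  obtain ⟨-, ⟨hgood, hord⟩, h5, -, -, -⟩ := id hX9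
  refine X9.bsdp_of_trivialPartner_of_analyticRank_eq_one W A p hBCS hGr hΩ hGV hS hPR hmodP hGZK
    hX9 hr hgoodA hordA hna htam hL hSel hC1 fun Dh hDh => ?_
  exact (Wuthrich2014.coeff_one_padicLFunction_ne_zero_iff_schneider hPR hGZK W p h5
    ⟨hgood, hord⟩ hr Dh hDh f hf).mp hC3

/-! ### The canonical cell shape and the typed output -/

/-- **Route U2 in the canonical shape of the cell (`r_an ≤ 1 → ClassX9 W p → … → BSDp W p`).**
Both ranks at once: C3 is asked only in analytic rank 1 (`hC3 : W.analyticRank = 1 → …`).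
PUBLISHED inputs `hBCS`, `hGr`, `hΩ`, `hGV`, `hS`, `hPR`, `hmodP`, `hmodL`, `hGZK`; per-pair
certificates `hna`, `htam`, `hL`, `hSel` (partner), C1 (, C3). [cite: GreenbergVatsal2000, Thm. (1.4) (arXiv p. 5)]
[cite: GreenbergLNM1716, Thm. 4.1 (p. 102)] [cite: PerrinRiou1987, §1.4 Cor. 1.8] -/
theorem X9.bsdp_of_trivialPartner_of_analyticRank_le_one
    (hBCS : burungale_castella_skinner_charIdeal_eq_padicLFunction)
    (hGr : greenberg_charValue_rankZero) (hΩ : realPeriodRat_eq_unit_mul_plusPeriod)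
    (hGV : GreenbergVatsal2000.thm14_mainConjecture_transfer_of_torsionIso)
    (hS : Schneider1985_order_charGenerator) (hPR : perrinRiou_rankOne_leadingTerms)
    (hmodP : nonempty_modularParametrizationData) (hmodL : hasEntireLFunction_rat)
    (hGZK : rank_eq_analyticRank_of_analyticRank_le_one)
    (hran : W.analyticRank ≤ 1) (hX9 : ClassX9 W p)
    (hgoodA : A.HasGoodReductionAtPrime p) (hordA : ¬ (p : ℤ) ∣ A.frobeniusTrace p)
    (hna : ¬ p ∣ A.reductionPointCount p) (htam : ¬ p ∣ A.tamagawaProduct)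
    (hL : ∃ q : ℚ, q ≠ 0 ∧ A.entireLFunction 1 / (A.realPeriodRat : ℂ) = (q : ℂ) ∧ padicValRat p q = 0)
    (hSel : Nat.card (A.selmerGroupPInfty p) = 1)
    (hC1 : ∃ e : geomTorsion A (p : ℤ) ≃+ geomTorsion W (p : ℤ),
      ∀ (σ : Field.absoluteGaloisGroup ℚ) (P : geomTorsion A (p : ℤ)), e (σ • P) = σ • e P)
    (hC3 : W.analyticRank = 1 → ∀ Dh : PAdicHeightData W p, Dh.IsCanonical → SchneiderConjecture Dh) :
    BSDp W p := by
  rcases Nat.le_one_iff_eq_zero_or_eq_one.mp hran with hr | hr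
  · exact X9.bsdp_of_trivialPartner W A p hBCS hGr hΩ hGV hmodP hmodL hGZK hX9 hr hgoodA hordA hna
      htam hL hSel hC1
  · exact X9.bsdp_of_trivialPartner_of_analyticRank_eq_one W A p hBCS hGr hΩ hGV hS hPR hmodP hGZK
      hX9 hr hgoodA hordA hna htam hL hSel hC1 (hC3 hr)

/-- **The typed X9 output is inhabited at a certified pair of route U2.** Under the hypotheses of
`X9.bsdp_of_trivialPartner_of_analyticRank_le_one`, `Typed.X9.MissingInputAt W p` holds.
[cite: Miller2011LMS, Def. 1.1] [cite: GreenbergVatsal2000, Thm. (1.4) (arXiv p. 5)] -/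
theorem X9.missingInputAt_of_trivialPartner
    (hBCS : burungale_castella_skinner_charIdeal_eq_padicLFunction)
    (hGr : greenberg_charValue_rankZero) (hΩ : realPeriodRat_eq_unit_mul_plusPeriod)
    (hGV : GreenbergVatsal2000.thm14_mainConjecture_transfer_of_torsionIso)
    (hS : Schneider1985_order_charGenerator) (hPR : perrinRiou_rankOne_leadingTerms)
    (hmodP : nonempty_modularParametrizationData) (hmodL : hasEntireLFunction_rat)
    (hGZK : rank_eq_analyticRank_of_analyticRank_le_one)
    (hran : W.analyticRank ≤ 1) (hX9 : ClassX9 W p)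
    (hgoodA : A.HasGoodReductionAtPrime p) (hordA : ¬ (p : ℤ) ∣ A.frobeniusTrace p)
    (hna : ¬ p ∣ A.reductionPointCount p) (htam : ¬ p ∣ A.tamagawaProduct)
    (hL : ∃ q : ℚ, q ≠ 0 ∧ A.entireLFunction 1 / (A.realPeriodRat : ℂ) = (q : ℂ) ∧ padicValRat p q = 0)
    (hSel : Nat.card (A.selmerGroupPInfty p) = 1)
    (hC1 : ∃ e : geomTorsion A (p : ℤ) ≃+ geomTorsion W (p : ℤ),
      ∀ (σ : Field.absoluteGaloisGroup ℚ) (P : geomTorsion A (p : ℤ)), e (σ • P) = σ • e P)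
    (hC3 : W.analyticRank = 1 → ∀ Dh : PAdicHeightData W p, Dh.IsCanonical → SchneiderConjecture Dh) :
    Typed.X9.MissingInputAt W p := by
  haveI : Finite W.sha := (hGZK W hran).2
  exact Typed.X9.missingInputAt_of_bsdp W p
    (X9.bsdp_of_trivialPartner_of_analyticRank_le_one W A p hBCS hGr hΩ hGV hS hPR hmodP hmodL hGZK
      hran hX9 hgoodA hordA hna htam hL hSel hC1 hC3)

/-! ### C1 as the Kraus–Oesterlé congruence list -/

/-- **Route U2 with C1 as Kraus–Oesterlé congruences, both ranks (canonical cell shape).** As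
`X9.bsdp_of_trivialPartner_of_analyticRank_le_one`, with the `Γ_ℚ`-equivariant `A[p] ≃ E[p]`
DERIVED from the finite trace congruences `hcong` below the Kraus–Oesterlé bound by the named fact
`hKO` (`KrausOesterle1992.torsionIso_of_congruences`; irreducibility of `E[p]` from `ClassX9`).
[cite: KrausOesterle1992, Prop. 4] [cite: GreenbergVatsal2000, Thm. (1.4) (arXiv p. 5)] -/
theorem X9.bsdp_of_trivialPartner_of_congruences_of_analyticRank_le_one
    (hKO : KrausOesterle1992.prop4_torsionIso_of_congruences)
    (hBCS : burungale_castella_skinner_charIdeal_eq_padicLFunction)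
    (hGr : greenberg_charValue_rankZero) (hΩ : realPeriodRat_eq_unit_mul_plusPeriod)
    (hGV : GreenbergVatsal2000.thm14_mainConjecture_transfer_of_torsionIso)
    (hS : Schneider1985_order_charGenerator) (hPR : perrinRiou_rankOne_leadingTerms)
    (hmodP : nonempty_modularParametrizationData) (hmodL : hasEntireLFunction_rat)
    (hGZK : rank_eq_analyticRank_of_analyticRank_le_one)
    (hran : W.analyticRank ≤ 1) (hX9 : ClassX9 W p)
    (hgoodA : A.HasGoodReductionAtPrime p) (hordA : ¬ (p : ℤ) ∣ A.frobeniusTrace p)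
    (hna : ¬ p ∣ A.reductionPointCount p) (htam : ¬ p ∣ A.tamagawaProduct)
    (hL : ∃ q : ℚ, q ≠ 0 ∧ A.entireLFunction 1 / (A.realPeriodRat : ℂ) = (q : ℂ) ∧ padicValRat p q = 0)
    (hSel : Nat.card (A.selmerGroupPInfty p) = 1)
    (hcong : ∀ (ℓ : ℕ) [Fact ℓ.Prime],
      6 * ℓ < KrausOesterle1992.gammaZeroIndex (KrausOesterle1992.modulus W A) →
      (padicValNat ℓ (W.conductorNorm ℤ * A.conductorNorm ℤ) = 0 →
          (p : ℤ) ∣ W.frobeniusTrace ℓ - A.frobeniusTrace ℓ) ∧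
        (padicValNat ℓ (W.conductorNorm ℤ * A.conductorNorm ℤ) = 1 →
          (p : ℤ) ∣ W.frobeniusTrace ℓ * A.frobeniusTrace ℓ - (ℓ + 1)))
    (hC3 : W.analyticRank = 1 → ∀ Dh : PAdicHeightData W p, Dh.IsCanonical → SchneiderConjecture Dh) :
    BSDp W p := by
  obtain ⟨-, -, -, hirr, -, -⟩ := id hX9
  exact X9.bsdp_of_trivialPartner_of_analyticRank_le_one W A p hBCS hGr hΩ hGV hS hPR hmodP hmodL
    hGZK hran hX9 hgoodA hordA hna htam hL hSel
    (KrausOesterle1992.torsionIso_of_congruences hKO W A p hirr hcong) hC3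

/-- **Rank 0 with C1 as Kraus–Oesterlé congruences** (no Schneider certificate, no rank-one facts).
[cite: KrausOesterle1992, Prop. 4] [cite: GreenbergVatsal2000, Thm. (1.4) (arXiv p. 5)]
[cite: GreenbergLNM1716, Thm. 4.1 (p. 102)] -/
theorem X9.bsdp_of_trivialPartner_of_congruences
    (hKO : KrausOesterle1992.prop4_torsionIso_of_congruences)
    (hBCS : burungale_castella_skinner_charIdeal_eq_padicLFunction)
    (hGr : greenberg_charValue_rankZero) (hΩ : realPeriodRat_eq_unit_mul_plusPeriod)
    (hGV : GreenbergVatsal2000.thm14_mainConjecture_transfer_of_torsionIso)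
    (hmodP : nonempty_modularParametrizationData) (hmodL : hasEntireLFunction_rat)
    (hGZK : rank_eq_analyticRank_of_analyticRank_le_one)
    (hX9 : ClassX9 W p) (hr : W.analyticRank = 0)
    (hgoodA : A.HasGoodReductionAtPrime p) (hordA : ¬ (p : ℤ) ∣ A.frobeniusTrace p)
    (hna : ¬ p ∣ A.reductionPointCount p) (htam : ¬ p ∣ A.tamagawaProduct)
    (hL : ∃ q : ℚ, q ≠ 0 ∧ A.entireLFunction 1 / (A.realPeriodRat : ℂ) = (q : ℂ) ∧ padicValRat p q = 0)
    (hSel : Nat.card (A.selmerGroupPInfty p) = 1)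
    (hcong : ∀ (ℓ : ℕ) [Fact ℓ.Prime],
      6 * ℓ < KrausOesterle1992.gammaZeroIndex (KrausOesterle1992.modulus W A) →
      (padicValNat ℓ (W.conductorNorm ℤ * A.conductorNorm ℤ) = 0 →
          (p : ℤ) ∣ W.frobeniusTrace ℓ - A.frobeniusTrace ℓ) ∧
        (padicValNat ℓ (W.conductorNorm ℤ * A.conductorNorm ℤ) = 1 →
          (p : ℤ) ∣ W.frobeniusTrace ℓ * A.frobeniusTrace ℓ - (ℓ + 1))) :
    BSDp W p := by
  obtain ⟨-, -, -, hirr, -, -⟩ := id hX9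
  exact X9.bsdp_of_trivialPartner W A p hBCS hGr hΩ hGV hmodP hmodL hGZK hX9 hr hgoodA hordA hna htam
    hL hSel (KrausOesterle1992.torsionIso_of_congruences hKO W A p hirr hcong)

/-- **Route U2 with a partner of conductor `< 5000`, both ranks: every certificate finite and every
input published.** The partner's Selmer certificate is discharged by Miller / Creutz–Miller
(`hMiller`, `bsdp_of_irreducible_of_conductor_lt`) from `r_an(A) = 0`, `N_A < 5000`, `p ∤ ∏ c_ℓ(A)`,
`ord_p(L(A,1)/Ω_A) = 0` (`natCard_selmerGroupPInfty_eq_one_of_conductor_lt`); C1 is the Kraus–Oesterlé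
list. Remaining binders: PUBLISHED facts `hKO`, `hMiller`, `hBCS`, `hGr`, `hΩ`, `hGV`, `hS`, `hPR`,
`hmodP`, `hmodL`, `hGZK`; FINITE certificates `hrA` (`r_an(A) = 0`, i.e. `L(A,1) ≠ 0`), `hNA`, `hna`,
`htam`, `hL`, `hcong`, and C3 in rank 1. [cite: Miller2011LMS, Thm. 1.2] [cite: CreutzMiller2012, Thm. 1.1]
[cite: KrausOesterle1992, Prop. 4] [cite: GreenbergVatsal2000, Thm. (1.4) (arXiv p. 5)] -/
theorem X9.bsdp_of_trivialPartner_of_conductor_lt_of_analyticRank_le_one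
    (hKO : KrausOesterle1992.prop4_torsionIso_of_congruences)
    (hMiller : bsdp_of_irreducible_of_conductor_lt)
    (hBCS : burungale_castella_skinner_charIdeal_eq_padicLFunction)
    (hGr : greenberg_charValue_rankZero) (hΩ : realPeriodRat_eq_unit_mul_plusPeriod)
    (hGV : GreenbergVatsal2000.thm14_mainConjecture_transfer_of_torsionIso)
    (hS : Schneider1985_order_charGenerator) (hPR : perrinRiou_rankOne_leadingTerms)
    (hmodP : nonempty_modularParametrizationData) (hmodL : hasEntireLFunction_rat)
    (hGZK : rank_eq_analyticRank_of_analyticRank_le_one)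
    (hran : W.analyticRank ≤ 1) (hX9 : ClassX9 W p)
    (hgoodA : A.HasGoodReductionAtPrime p) (hordA : ¬ (p : ℤ) ∣ A.frobeniusTrace p)
    (hrA : A.analyticRank = 0) (hNA : A.conductorNorm ℤ < 5000)
    (hna : ¬ p ∣ A.reductionPointCount p) (htam : ¬ p ∣ A.tamagawaProduct)
    (hL : ∃ q : ℚ, q ≠ 0 ∧ A.entireLFunction 1 / (A.realPeriodRat : ℂ) = (q : ℂ) ∧ padicValRat p q = 0)
    (hcong : ∀ (ℓ : ℕ) [Fact ℓ.Prime],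
      6 * ℓ < KrausOesterle1992.gammaZeroIndex (KrausOesterle1992.modulus W A) →
      (padicValNat ℓ (W.conductorNorm ℤ * A.conductorNorm ℤ) = 0 →
          (p : ℤ) ∣ W.frobeniusTrace ℓ - A.frobeniusTrace ℓ) ∧
        (padicValNat ℓ (W.conductorNorm ℤ * A.conductorNorm ℤ) = 1 →
          (p : ℤ) ∣ W.frobeniusTrace ℓ * A.frobeniusTrace ℓ - (ℓ + 1)))
    (hC3 : W.analyticRank = 1 → ∀ Dh : PAdicHeightData W p, Dh.IsCanonical → SchneiderConjecture Dh) :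
    BSDp W p := by
  obtain ⟨-, -, -, hirr, -, -⟩ := id hX9
  have hC1 := KrausOesterle1992.torsionIso_of_congruences hKO W A p hirr hcong
  obtain ⟨e, he⟩ := hC1
  have hirrA : A.HasIrreducibleModPGaloisRep p :=
    hasIrreducibleModPGaloisRep_of_torsionIso_symm e he hirr
  exact X9.bsdp_of_trivialPartner_of_analyticRank_le_one W A p hBCS hGr hΩ hGV hS hPR hmodP hmodL
    hGZK hran hX9 hgoodA hordA hna htam hL
    (natCard_selmerGroupPInfty_eq_one_of_conductor_lt hMiller hGZK A p hirrA hrA hNA htam hL)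
    ⟨e, he⟩ hC3

end TrivialPartner

/-! ## Appended (gen 5, same seat): odd primes — route U2 at every odd good ordinary prime, and
## class X10b (= X9's shape at `p = 3`), analytic rank 0

BCS 2025 Thm. 1.1.2 (a) (`p > 3`) was used above for the partner only to know that `X(A/ℚ_∞)` is
`Λ`-torsion with a principal characteristic ideal. Torsion is Kato 2004 Thm. 17.4 (1) at every odd
good ordinary prime (tree fact `kato_divisibility`), and the characteristic ideal of any `Λ`-module is
principal (`charIdeal_isPrincipal_holds`); Greenberg's Thm. 4.1, integrality
(`padicLFunction_mem_integral_holds`) and the period unit (`realPeriodRat_eq_unit_mul_plusPeriod`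
for `p ≥ 5`, `…_three` for `p = 3`) carry no restriction beyond `p` odd; Greenberg–Vatsal's
Thm. (1.4) is printed for odd `p`; and the rank-0 glue `pPartRankZero_of_thm14` likewise. Hence
route U2 serves, in analytic rank `0`, every odd good ordinary prime with `E[p]` irreducible — in
particular class **X10b** (`ClassX10 W p`, so `p = 3`, with `ρ̄_{E,3}` not surjective; (Im) false,
`ClassX10.not_bigIm_of_not_surj`; referee R6.1/R7.1: carries X9's label). Census note (prover's scan
`x10b_u2_scan.py`, lane to certify): the X10b residue pair `1690i1 @ 3` (rank 0; no CM partner,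
gen 4) is congruent mod `3` to `338d1` (`N = 338 < 5000`, rank 0, trivial `3`-primary arithmetic).
The rank-1 half of X10b is NOT touched (the rank-one engine needs `p ≥ 5`). -/

/-- The period ratio is a `p`-adic unit at every odd good prime with `E[p]` irreducible: `p ≥ 5`
from `realPeriodRat_eq_unit_mul_plusPeriod`, `p = 3` from `realPeriodRat_eq_unit_mul_plusPeriod_three`.
[cite: GreenbergVatsal2000, §3 Remark (3.4)] [cite: Mazur1978, Cor. 4.1] -/
theorem norm_periodRatio_eq_one_of_odd (h5 : realPeriodRat_eq_unit_mul_plusPeriod)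
    (h3 : realPeriodRat_eq_unit_mul_plusPeriod_three)
    (A : WeierstrassCurve ℚ) [A.IsElliptic] [A.IsGloballyMinimal] (p : ℕ) [Fact p.Prime]
    (hp : p ≠ 2) (hgood : A.HasGoodReductionAtPrime p) (hirr : A.HasIrreducibleModPGaloisRep p)
    {N : ℕ} [NeZero N] (f : CuspForm (Gamma0 N) 2) (hf : IsNewformOf A f) (ϖ : ℚ)
    (hϖeq : (ϖ : ℝ) * A.realPeriodRat = plusPeriod f) : ‖(ϖ : ℚ_[p])‖ = 1 := by
  have hpP : p.Prime := Fact.out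
  have hplus : plusPeriod f ≠ 0 := (IsNewform0.plusPeriod_pos_holds hf.1 hf.coeffField_eq_bot).ne'
  -- `Ω_A = u · Ω⁺_f` with `‖u‖_p = 1`, at `p = 3` and at `p ≥ 5`
  have hu : ∃ u : ℚ, ‖(u : ℚ_[p])‖ = 1 ∧ A.realPeriodRat = u * plusPeriod f := by
    by_cases h3p : p = 3
    · subst h3p
      exact h3 A hgood hirr f hf
    · have h4 : p ≠ 4 := by
        rintro rfl
        exact absurd hpP (by decide)
      have hp5 : 5 ≤ p := by have := hpP.two_le; omega
      exact h5 A p hp5 hgood hirr f hf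
  obtain ⟨u, hu1, huΩ⟩ := hu
  have hϖu : ϖ * u = 1 := by
    have h1 : ((ϖ * u : ℚ) : ℝ) * plusPeriod f = ((1 : ℚ) : ℝ) * plusPeriod f := by
      calc ((ϖ * u : ℚ) : ℝ) * plusPeriod f = (ϖ : ℝ) * ((u : ℝ) * plusPeriod f) := by
            push_cast; ring
        _ = (ϖ : ℝ) * A.realPeriodRat := by rw [← huΩ]
        _ = plusPeriod f := hϖeq
        _ = ((1 : ℚ) : ℝ) * plusPeriod f := by push_cast; rw [one_mul]
    exact_mod_cast mul_right_cancel₀ hplus h1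
  have h := congrArg (fun r : ℚ => ‖(r : ℚ_[p])‖) hϖu
  simp only [Rat.cast_mul, norm_mul, hu1, mul_one, Rat.cast_one, norm_one] at h
  exact h

/-- **Trivial `p`-primary arithmetic ⟹ Mazur's main conjecture with `μ = 0`, at every ODD good
ordinary prime with `A[p]` irreducible.** As `mazurMainConjecture_with_mu_zero_of_trivialArithmetic`,
with BCS (a) replaced by Kato 2004 Thm. 17.4 (1) (`hkato`, tree fact `kato_divisibility`: `X(A/ℚ_∞)`
is `Λ`-torsion at an odd good ordinary prime) and the principal generator taken from
`charIdeal_isPrincipal_holds` (`Λ` a UFD); period unit from `h5`/`h3`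
(`norm_periodRatio_eq_one_of_odd`). [cite: Kato2004Asterisque, Thm. 17.4 (1) (p. 273)]
[cite: GreenbergLNM1716, Thm. 4.1 (p. 102) and Prop. 3.8 (p. 95)] [cite: GreenbergVatsal2000, Prop. 3.7] -/
theorem mazurMainConjecture_with_mu_zero_of_trivialArithmetic_odd
    (hkato : ∀ (W : WeierstrassCurve ℚ) [W.IsElliptic] [W.IsGloballyMinimal] (p : ℕ) [Fact p.Prime]
      (κ : ZpExtension ℚ p) (γ : Field.absoluteGaloisGroup ℚ) (N : ℕ) [NeZero N]
      (f : CuspForm (Gamma0 N) 2), kato_divisibility W p (κ := κ) (γ := γ) (f := f))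
    (hGr : greenberg_charValue_rankZero) (h5 : realPeriodRat_eq_unit_mul_plusPeriod)
    (h3 : realPeriodRat_eq_unit_mul_plusPeriod_three)
    (A : WeierstrassCurve ℚ) [A.IsElliptic] [A.IsGloballyMinimal] (p : ℕ) [Fact p.Prime]
    (hp2 : p ≠ 2) (hgood : A.HasGoodReductionAtPrime p) (hord : ¬ (p : ℤ) ∣ A.frobeniusTrace p)
    (hirr : A.HasIrreducibleModPGaloisRep p)
    (hna : ¬ p ∣ A.reductionPointCount p) (htam : ¬ p ∣ A.tamagawaProduct)
    (hL : ∃ q : ℚ, q ≠ 0 ∧ A.entireLFunction 1 / (A.realPeriodRat : ℂ) = (q : ℂ) ∧ padicValRat p q = 0)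
    (hSel : Nat.card (A.selmerGroupPInfty p) = 1) :
    ∀ (κ : ZpExtension ℚ p) (γ : Field.absoluteGaloisGroup ℚ),
        κ.IsCyclotomic → κ.IsTopGenerator γ → IsCyclotomicVariable p γ →
      ∀ [NeZero (A.conductorNorm ℤ)] (fA : CuspForm (Gamma0 (A.conductorNorm ℤ)) 2),
        IsNewformOf A fA → ∀ (ϖ : ℚ), (ϖ : ℝ) * A.realPeriodRat = plusPeriod fA →
      ∀ (D : A.SelmerDualData κ γ), D.IsTorsion ∧
        ∃ g : IwasawaAlgebra p, D.charIdeal = Ideal.span {g} ∧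
          GreenbergVatsal2000.HasUnitContent g ∧
          iwasawaToPowerSeries p g =
            PowerSeries.C (ϖ : ℚ_[p]) * padicLFunction fA (unitRoot A p : ℚ_[p]) := by
  intro κ γ hκ hγ hγ' _ fA hf ϖ hϖeq D
  have hpP : p.Prime := Fact.out
  have hordp : IsOrdinaryAt A p := ⟨hgood, hord⟩
  haveI : Module.Finite (IwasawaAlgebra p) D.X := D.module_finite_holds hγ
  haveI : NeZero p := ⟨hpP.ne_zero⟩
  -- the rational number `t = ϖ · [0]⁺ = L(A,1)/Ω_A` and its valuation
  obtain ⟨q, hq0, hqeq, hqv⟩ := hL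
  set s : ℚ := ratPlusSymbol fA 0 with hs_def
  have hΩpos : 0 < A.realPeriodRat := A.realPeriodRat_pos_holds
  have hLval : A.entireLFunction 1 = (((s : ℝ) * plusPeriod fA : ℝ) : ℂ) := hf.entireLFunction_one_eq
  have ht : A.entireLFunction 1 / (A.realPeriodRat : ℂ) = ((ϖ * s : ℚ) : ℂ) := by
    rw [hLval, ← hϖeq, div_eq_iff (Complex.ofReal_ne_zero.mpr hΩpos.ne')]
    push_cast
    ring
  have hqt : q = ϖ * s := by
    have h := hqeq.symm.trans ht
    exact_mod_cast h
  have hϖnorm : ‖(ϖ : ℚ_[p])‖ = 1 :=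
    norm_periodRatio_eq_one_of_odd h5 h3 A p hp2 hgood hirr fA hf ϖ hϖeq
  -- Step 1 (Kato 17.4 (1) + `Λ` a UFD): `X` torsion, `char X = (g₀)`
  have hX : D.IsTorsion := (hkato A p κ γ _ fA hp2 hordp hκ hγ hγ' hf D).1
  haveI : (Module.charIdeal (IwasawaAlgebra p) D.X).IsPrincipal := charIdeal_isPrincipal_holds p D.X
  obtain ⟨g₀, hchar⟩ := Submodule.IsPrincipal.principal (Module.charIdeal (IwasawaAlgebra p) D.X)
  replace hchar : D.charIdeal = Ideal.span {g₀} := hchar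
  -- Step 2 (Greenberg's Thm. 4.1 with `#Sel = 1`, `p ∤ ∏c`, `p ∤ #Ã(𝔽_p)`): `g₀` is a unit of `Λ`
  have hSelfin : Finite (A.selmerGroupPInfty p) :=
    Nat.finite_of_card_ne_zero (by rw [hSel]; exact one_ne_zero)
  obtain ⟨hEfin, -⟩ := (A.finite_selmerGroupPInfty_iff p).mp hSelfin
  haveI := hEfin
  obtain ⟨u₁, hu₁⟩ := hGr A p hp2 hgood hord κ γ hκ hγ hγ' D hX g₀ hchar hSelfin
  obtain ⟨u₃, hu₃⟩ := exists_unit_natCard_eq_mul_card_primaryComponent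
    ((integralModelInt A).map (Int.castRingHom (ZMod p))).toAffine.Point p
  set Np : ℚ_[p] := (Nat.card (AddCommGroup.primaryComponent
    ((integralModelInt A).map (Int.castRingHom (ZMod p))).toAffine.Point p) : ℚ_[p]) with hNp
  set Tp : ℚ_[p] := (Nat.card (AddCommGroup.primaryComponent A.toAffine.Point p) : ℚ_[p]) with hTp
  have hNcount : (A.reductionPointCount p : ℚ_[p]) = ((u₃ : ℤ_[p]) : ℚ_[p]) * Np := by
    rw [WeierstrassCurve.reductionPointCount, hNp]
    exact hu₃
  have hNp0 : Np ≠ 0 := by rw [hNp]; exact_mod_cast Nat.card_pos.ne'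
  have hTp0 : Tp ≠ 0 := by rw [hTp]; exact_mod_cast Nat.card_pos.ne'
  have hvNp : Np.valuation = 0 := by
    have h := congrArg Padic.valuation hNcount
    rw [Padic.valuation_natCast, Padic.valuation_mul (coe_units_ne_zero p u₃) hNp0,
      valuation_coe_units_eq_zero, zero_add, padicValNat.eq_zero_of_not_dvd hna] at h
    exact_mod_cast h.symm
  have hv0 : padicValNat p A.tamagawaProduct = 0 := padicValNat.eq_zero_of_not_dvd htam
  rw [hv0, pow_zero, mul_one, hSel, Nat.cast_one, mul_one] at hu₁
  have hg00 : ((PowerSeries.constantCoeff g₀ : ℤ_[p]) : ℚ_[p]) ≠ 0 := by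
    intro h
    rw [h, zero_mul] at hu₁
    exact (mul_ne_zero (coe_units_ne_zero p u₁) (pow_ne_zero 2 hNp0)) hu₁.symm
  have hvg0 : ((PowerSeries.constantCoeff g₀ : ℤ_[p]) : ℚ_[p]).valuation = 0 := by
    have h := congrArg Padic.valuation hu₁
    rw [Padic.valuation_mul hg00 (pow_ne_zero 2 hTp0), Padic.valuation_pow,
      Padic.valuation_mul (coe_units_ne_zero p u₁) (pow_ne_zero 2 hNp0), valuation_coe_units_eq_zero,
      Padic.valuation_pow, hvNp, mul_zero, zero_add] at h
    have hT : 0 ≤ Tp.valuation := by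
      rw [hTp, Padic.valuation_natCast]; exact_mod_cast Nat.zero_le _
    have hg : 0 ≤ ((PowerSeries.constantCoeff g₀ : ℤ_[p]) : ℚ_[p]).valuation :=
      valuation_coe_padicInt_nonneg _ hg00
    simp only [Nat.cast_ofNat] at h
    linarith
  have hg0unit : IsUnit g₀ :=
    PowerSeries.isUnit_iff_constantCoeff.mpr (isUnit_of_valuation_coe_eq_zero _ hg00 hvg0)
  have hchar_top : D.charIdeal = ⊤ := by rw [hchar, Ideal.span_singleton_eq_top]; exact hg0unit
  -- Step 3 (integrality): `G := ϖ · L_p(f_A, α) ∈ Λ`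
  set L := padicLFunction fA (unitRoot A p : ℚ_[p]) with hLdef
  have hcoef : ∀ n : ℕ, ‖PowerSeries.coeff n (PowerSeries.C (ϖ : ℚ_[p]) * L)‖ ≤ 1 := by
    intro n
    rw [PowerSeries.coeff_C_mul, norm_mul, hϖnorm, one_mul, hLdef, coeff_padicLFunction]
    exact padicLFunction_mem_integral_holds hp2 hordp hf hirr n
  set G : IwasawaAlgebra p := PowerSeries.mk fun n =>
    (⟨PowerSeries.coeff n (PowerSeries.C (ϖ : ℚ_[p]) * L), hcoef n⟩ : ℤ_[p]) with hGdef
  have hιG : iwasawaToPowerSeries p G = PowerSeries.C (ϖ : ℚ_[p]) * L := by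
    ext n
    rw [iwasawaToPowerSeries, PowerSeries.coeff_map, hGdef, PowerSeries.coeff_mk]
    rfl
  -- Step 4 (interpolation): `G(0) = ϖ (1 - α⁻¹)² [0]⁺_{f_A}` is a unit
  set a : ℚ_[p] := ((unitRoot A p : ℤ_[p]) : ℚ_[p]) with ha
  obtain ⟨u₂, hu₂⟩ := exists_unit_one_sub_unitRoot_inv p A hordp
  have h1a : (1 - a⁻¹) = ((u₂ : ℤ_[p]) : ℚ_[p]) * ((u₃ : ℤ_[p]) : ℚ_[p]) * Np := by
    rw [ha, hu₂, hNcount, mul_assoc]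
  have h1a0 : (1 - a⁻¹) ≠ 0 := by
    rw [h1a]; exact mul_ne_zero (mul_ne_zero (coe_units_ne_zero p u₂) (coe_units_ne_zero p u₃)) hNp0
  have hv1a : (1 - a⁻¹).valuation = 0 := by
    rw [h1a, Padic.valuation_mul (mul_ne_zero (coe_units_ne_zero p u₂) (coe_units_ne_zero p u₃)) hNp0,
      Padic.valuation_mul (coe_units_ne_zero p u₂) (coe_units_ne_zero p u₃),
      valuation_coe_units_eq_zero, valuation_coe_units_eq_zero, hvNp, add_zero, add_zero]
  have htQ0 : ((q : ℚ) : ℚ_[p]) ≠ 0 := by exact_mod_cast hq0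
  have hG0 : ((PowerSeries.constantCoeff G : ℤ_[p]) : ℚ_[p]) = (1 - a⁻¹) ^ 2 * (q : ℚ_[p]) := by
    rw [← constantCoeff_iwasawaToPowerSeries p G, hιG, map_mul, PowerSeries.constantCoeff_C, hLdef,
      constantCoeff_padicLFunction_unitRoot hordp hf, hqt]
    push_cast
    rw [ha]
    ring
  have hG00 : ((PowerSeries.constantCoeff G : ℤ_[p]) : ℚ_[p]) ≠ 0 := by
    rw [hG0]; exact mul_ne_zero (pow_ne_zero 2 h1a0) htQ0
  have hvG0 : ((PowerSeries.constantCoeff G : ℤ_[p]) : ℚ_[p]).valuation = 0 := by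
    rw [hG0, Padic.valuation_mul (pow_ne_zero 2 h1a0) htQ0, Padic.valuation_pow, hv1a,
      Padic.valuation_ratCast, hqv]
    simp
  have hG0unit : IsUnit (PowerSeries.constantCoeff G) := isUnit_of_valuation_coe_eq_zero _ hG00 hvG0
  have hGunit : IsUnit G := PowerSeries.isUnit_iff_constantCoeff.mpr hG0unit
  refine ⟨hX, G, ?_, ⟨0, ?_⟩, hιG⟩
  · rw [hchar_top, eq_comm, Ideal.span_singleton_eq_top]; exact hGunit
  · rw [PowerSeries.coeff_zero_eq_constantCoeff]; exact hG0unit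

section OddPrime

variable (W A : WeierstrassCurve ℚ) [W.IsElliptic] [W.IsGloballyMinimal] [A.IsElliptic]
  [A.IsGloballyMinimal] (p : ℕ) [Fact p.Prime]

/-- **Route U2 at any odd good ordinary prime, analytic rank 0 (no class predicate): `BSD(E,p)`
from a congruent partner with trivial `p`-primary arithmetic.** For `W` globally minimal with `p ≠ 2`
good ordinary, `E[p]` irreducible, `W.analyticRank = 0`; a globally minimal partner `A` good ordinary at
`p` with the certificates `hna`, `htam`, `hL`, `hSel`; and C1 (`hC1`). PUBLISHED binders: Kato 2004
Thm. 17.4 (1) (`hkato`), Greenberg LNM 1716 Thm. 4.1 (`hGr`), the period unit at `p ≥ 5` (`h5`) and at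
`p = 3` (`h3`), Greenberg–Vatsal 2000 Thm. (1.4) + (1.2) (`hGV`), modularity (`hmodP`, `hmodL`), GZK
(`hGZK`). This is `X9.bsdp_of_trivialPartner` with the class predicate replaced by its used conjuncts
and `p ≥ 5` relaxed to `p` odd, so that it applies verbatim at `p = 3`.
[cite: Kato2004Asterisque, Thm. 17.4 (1) (p. 273)] [cite: GreenbergVatsal2000, Thm. (1.4) (arXiv p. 5)]
[cite: GreenbergLNM1716, Thm. 4.1 (p. 102)] -/
theorem bsdp_of_trivialPartner_of_goodOrd
    (hkato : ∀ (W : WeierstrassCurve ℚ) [W.IsElliptic] [W.IsGloballyMinimal] (p : ℕ) [Fact p.Prime]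
      (κ : ZpExtension ℚ p) (γ : Field.absoluteGaloisGroup ℚ) (N : ℕ) [NeZero N]
      (f : CuspForm (Gamma0 N) 2), kato_divisibility W p (κ := κ) (γ := γ) (f := f))
    (hGr : greenberg_charValue_rankZero) (h5 : realPeriodRat_eq_unit_mul_plusPeriod)
    (h3 : realPeriodRat_eq_unit_mul_plusPeriod_three)
    (hGV : GreenbergVatsal2000.thm14_mainConjecture_transfer_of_torsionIso)
    (hmodP : nonempty_modularParametrizationData) (hmodL : hasEntireLFunction_rat)
    (hGZK : rank_eq_analyticRank_of_analyticRank_le_one)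
    (hp2 : p ≠ 2) (hgood : W.HasGoodReductionAtPrime p) (hord : ¬ (p : ℤ) ∣ W.frobeniusTrace p)
    (hirr : W.HasIrreducibleModPGaloisRep p) (hr : W.analyticRank = 0)
    (hgoodA : A.HasGoodReductionAtPrime p) (hordA : ¬ (p : ℤ) ∣ A.frobeniusTrace p)
    (hna : ¬ p ∣ A.reductionPointCount p) (htam : ¬ p ∣ A.tamagawaProduct)
    (hL : ∃ q : ℚ, q ≠ 0 ∧ A.entireLFunction 1 / (A.realPeriodRat : ℂ) = (q : ℂ) ∧ padicValRat p q = 0)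
    (hSel : Nat.card (A.selmerGroupPInfty p) = 1)
    (hC1 : ∃ e : geomTorsion A (p : ℤ) ≃+ geomTorsion W (p : ℤ),
      ∀ (σ : Field.absoluteGaloisGroup ℚ) (P : geomTorsion A (p : ℤ)), e (σ • P) = σ • e P) :
    BSDp W p := by
  obtain ⟨e, he⟩ := hC1
  have hirrA : A.HasIrreducibleModPGaloisRep p :=
    hasIrreducibleModPGaloisRep_of_torsionIso_symm e he hirr
  have hL1 : W.entireLFunction 1 ≠ 0 := (W.analyticRank_eq_zero_iff_holds (hmodL W)).1 hr
  exact bsdp_of_pPartRankZero W p hmodL hGZK hr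
    (GreenbergVatsal2000.pPartRankZero_of_thm14 A W p hGV hmodP hGZK hp2 hgoodA hordA hgood hord
      ⟨e, he⟩ hirrA
      (mazurMainConjecture_with_mu_zero_of_trivialArithmetic_odd hkato hGr h5 h3 A p hp2 hgoodA hordA
        hirrA hna htam hL hSel)
      hL1 (hGr W p hp2 hgood hord))

/-- **Class X10b, analytic rank 0: `BSD(E,3)` from a congruent partner with trivial `3`-primary
arithmetic (route U2 at `p = 3`).** Hypotheses: `ClassX10 W p` (so `p = 3`, good ordinary at `3`,
`E[3]` irreducible), `ρ̄_{E,3}` not surjective (`_hns`, the X10b half of R7.1 — recorded, not used),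
`W.analyticRank = 0`; a globally minimal partner `A` good ordinary at `3` with `3 ∤ #Ã(𝔽_3)`,
`3 ∤ ∏ c_ℓ(A)`, `ord_3(L(A,1)/Ω_A) = 0`, `#Sel_{3^∞}(A/ℚ) = 1`; C1 at `p = 3`. PUBLISHED binders
`hkato`, `hGr`, `h5`, `h3`, `hGV`, `hmodP`, `hmodL`, `hGZK`. No pair closed until certified; the
rank-1 half of X10b is not touched. [cite: Kato2004Asterisque, Thm. 17.4 (1) (p. 273)]
[cite: GreenbergVatsal2000, Thm. (1.4) (arXiv p. 5)] [cite: GreenbergLNM1716, Thm. 4.1 (p. 102) and Prop. 3.8 (p. 95)] -/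
theorem X10b.bsdp_of_trivialPartner
    (hkato : ∀ (W : WeierstrassCurve ℚ) [W.IsElliptic] [W.IsGloballyMinimal] (p : ℕ) [Fact p.Prime]
      (κ : ZpExtension ℚ p) (γ : Field.absoluteGaloisGroup ℚ) (N : ℕ) [NeZero N]
      (f : CuspForm (Gamma0 N) 2), kato_divisibility W p (κ := κ) (γ := γ) (f := f))
    (hGr : greenberg_charValue_rankZero) (h5 : realPeriodRat_eq_unit_mul_plusPeriod)
    (h3 : realPeriodRat_eq_unit_mul_plusPeriod_three)
    (hGV : GreenbergVatsal2000.thm14_mainConjecture_transfer_of_torsionIso)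
    (hmodP : nonempty_modularParametrizationData) (hmodL : hasEntireLFunction_rat)
    (hGZK : rank_eq_analyticRank_of_analyticRank_le_one)
    (hX10 : ClassX10 W p) (_hns : ¬ Surj W 3) (hr : W.analyticRank = 0)
    (hgoodA : A.HasGoodReductionAtPrime p) (hordA : ¬ (p : ℤ) ∣ A.frobeniusTrace p)
    (hna : ¬ p ∣ A.reductionPointCount p) (htam : ¬ p ∣ A.tamagawaProduct)
    (hL : ∃ q : ℚ, q ≠ 0 ∧ A.entireLFunction 1 / (A.realPeriodRat : ℂ) = (q : ℂ) ∧ padicValRat p q = 0)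
    (hSel : Nat.card (A.selmerGroupPInfty p) = 1)
    (hC1 : ∃ e : geomTorsion A (p : ℤ) ≃+ geomTorsion W (p : ℤ),
      ∀ (σ : Field.absoluteGaloisGroup ℚ) (P : geomTorsion A (p : ℤ)), e (σ • P) = σ • e P) :
    BSDp W p := by
  obtain ⟨hp3, ⟨hgood, hord⟩, hirr, -⟩ := hX10
  subst hp3
  exact bsdp_of_trivialPartner_of_goodOrd W A 3 hkato hGr h5 h3 hGV hmodP hmodL hGZK (by decide)
    hgood hord hirr hr hgoodA hordA hna htam hL hSel hC1

/-- **Class X10b, rank 0, route U2 with C1 as the Kraus–Oesterlé congruence list and the partner's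
Selmer certificate from Miller / Creutz–Miller (`N_A < 5000`, `r_an(A) = 0`): every binder PUBLISHED
or FINITE.** [cite: KrausOesterle1992, Prop. 4] [cite: Miller2011LMS, Thm. 1.2] [cite: CreutzMiller2012, Thm. 1.1]
[cite: GreenbergVatsal2000, Thm. (1.4) (arXiv p. 5)] -/
theorem X10b.bsdp_of_trivialPartner_of_conductor_lt
    (hKO : KrausOesterle1992.prop4_torsionIso_of_congruences)
    (hMiller : bsdp_of_irreducible_of_conductor_lt)
    (hkato : ∀ (W : WeierstrassCurve ℚ) [W.IsElliptic] [W.IsGloballyMinimal] (p : ℕ) [Fact p.Prime]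
      (κ : ZpExtension ℚ p) (γ : Field.absoluteGaloisGroup ℚ) (N : ℕ) [NeZero N]
      (f : CuspForm (Gamma0 N) 2), kato_divisibility W p (κ := κ) (γ := γ) (f := f))
    (hGr : greenberg_charValue_rankZero) (h5 : realPeriodRat_eq_unit_mul_plusPeriod)
    (h3 : realPeriodRat_eq_unit_mul_plusPeriod_three)
    (hGV : GreenbergVatsal2000.thm14_mainConjecture_transfer_of_torsionIso)
    (hmodP : nonempty_modularParametrizationData) (hmodL : hasEntireLFunction_rat)
    (hGZK : rank_eq_analyticRank_of_analyticRank_le_one)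
    (hX10 : ClassX10 W p) (hns : ¬ Surj W 3) (hr : W.analyticRank = 0)
    (hgoodA : A.HasGoodReductionAtPrime p) (hordA : ¬ (p : ℤ) ∣ A.frobeniusTrace p)
    (hrA : A.analyticRank = 0) (hNA : A.conductorNorm ℤ < 5000)
    (hna : ¬ p ∣ A.reductionPointCount p) (htam : ¬ p ∣ A.tamagawaProduct)
    (hL : ∃ q : ℚ, q ≠ 0 ∧ A.entireLFunction 1 / (A.realPeriodRat : ℂ) = (q : ℂ) ∧ padicValRat p q = 0)
    (hcong : ∀ (ℓ : ℕ) [Fact ℓ.Prime],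
      6 * ℓ < KrausOesterle1992.gammaZeroIndex (KrausOesterle1992.modulus W A) →
      (padicValNat ℓ (W.conductorNorm ℤ * A.conductorNorm ℤ) = 0 →
          (p : ℤ) ∣ W.frobeniusTrace ℓ - A.frobeniusTrace ℓ) ∧
        (padicValNat ℓ (W.conductorNorm ℤ * A.conductorNorm ℤ) = 1 →
          (p : ℤ) ∣ W.frobeniusTrace ℓ * A.frobeniusTrace ℓ - (ℓ + 1))) :
    BSDp W p := by
  obtain ⟨hp3, -, hirr, -⟩ := id hX10
  have hirr' : W.HasIrreducibleModPGaloisRep p := by subst hp3; exact hirr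
  obtain ⟨e, he⟩ := KrausOesterle1992.torsionIso_of_congruences hKO W A p hirr' hcong
  have hirrA : A.HasIrreducibleModPGaloisRep p :=
    hasIrreducibleModPGaloisRep_of_torsionIso_symm e he hirr'
  exact X10b.bsdp_of_trivialPartner W A p hkato hGr h5 h3 hGV hmodP hmodL hGZK hX10 hns hr hgoodA hordA
    hna htam hL (natCard_selmerGroupPInfty_eq_one_of_conductor_lt hMiller hGZK A p hirrA hrA hNA htam hL)
    ⟨e, he⟩

/-- **The typed X10b output is inhabited at a certified rank-0 pair of route U2**:
`Typed.X10b.MissingInputAt W` (`= MissingPPartAt W 3`). [cite: Miller2011LMS, Def. 1.1] -/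
theorem X10b.missingInputAt_of_trivialPartner
    (hkato : ∀ (W : WeierstrassCurve ℚ) [W.IsElliptic] [W.IsGloballyMinimal] (p : ℕ) [Fact p.Prime]
      (κ : ZpExtension ℚ p) (γ : Field.absoluteGaloisGroup ℚ) (N : ℕ) [NeZero N]
      (f : CuspForm (Gamma0 N) 2), kato_divisibility W p (κ := κ) (γ := γ) (f := f))
    (hGr : greenberg_charValue_rankZero) (h5 : realPeriodRat_eq_unit_mul_plusPeriod)
    (h3 : realPeriodRat_eq_unit_mul_plusPeriod_three)
    (hGV : GreenbergVatsal2000.thm14_mainConjecture_transfer_of_torsionIso)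
    (hmodP : nonempty_modularParametrizationData) (hmodL : hasEntireLFunction_rat)
    (hGZK : rank_eq_analyticRank_of_analyticRank_le_one)
    (hX10 : ClassX10 W p) (hns : ¬ Surj W 3) (hr : W.analyticRank = 0)
    (hgoodA : A.HasGoodReductionAtPrime p) (hordA : ¬ (p : ℤ) ∣ A.frobeniusTrace p)
    (hna : ¬ p ∣ A.reductionPointCount p) (htam : ¬ p ∣ A.tamagawaProduct)
    (hL : ∃ q : ℚ, q ≠ 0 ∧ A.entireLFunction 1 / (A.realPeriodRat : ℂ) = (q : ℂ) ∧ padicValRat p q = 0)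
    (hSel : Nat.card (A.selmerGroupPInfty p) = 1)
    (hC1 : ∃ e : geomTorsion A (p : ℤ) ≃+ geomTorsion W (p : ℤ),
      ∀ (σ : Field.absoluteGaloisGroup ℚ) (P : geomTorsion A (p : ℤ)), e (σ • P) = σ • e P) :
    Typed.X10b.MissingInputAt W := by
  have h := X10b.bsdp_of_trivialPartner W A p hkato hGr h5 h3 hGV hmodP hmodL hGZK hX10 hns hr hgoodA
    hordA hna htam hL hSel hC1
  obtain ⟨hp3, -⟩ := id hX10
  subst hp3
  haveI : Finite W.sha := (hGZK W (by omega)).2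
  exact Typed.missingPPartAt_of_bsdp W 3 h

end OddPrime

end Literature.NumberTheory.EllipticCurves.Rank1Residual

end
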